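import Mathlib
import Summits.CriticalPhenomena.CardyFormulaZ2.Theorems.CardySelfRefinementDefs
import Literature.Probability.LatticeModels.ProdBernoulliIndependence
import HarnessLib

/-!
# Conditioning the coin product on the far field (line `far-field-is-a-quarter-turn`, crux
`TrivialSectorRate`, stmt-CriticalPhenomena-10266)

Registered helper stubs `prodBernoulli_real_eq_integral_cond` and `measurable_cond_real` of the
engine `stub_orbitAlignment`.  For the product coin measure `P = prodBernoulli p` on `Set Coin` and
ANY set `K` of coins, the restriction `S ↦ S ∩ K` ("inside `K`") and the far field `S ↦ S \ K` are
independent under `P` (the coordinates `ω ↦ (i ∈ ω)` are mutually independent,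
`prodBernoulli_iIndepFun_mem`, and `K`, `Kᶜ` are disjoint: Mathlib's `indep_iSup_of_disjoint`), so the
law of the pair `(S ∩ K, S \ K)` is the product of its marginals
(`indepFun_iff_map_prod_eq_prod_map_map`) and Fubini (`Measure.prod_apply_symm`) gives, for every
measurable event `X`, the disintegration

`P(X) = ∫ ν_K {T | T ∪ (S \ K) ∈ X} dP(S)`,  `ν_K :=` the law of `S ∩ K`,

with a measurable integrand (`measurable_measure_prodMk_right`).  Everything is first proved for an
arbitrary index type `ι` (`prodBernoulli_indepFun_inter_sdiff`,
`prodBernoulli_map_inter_sdiff_eq_prod`, `prodBernoulli_measurable_map_inter_real`,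
`prodBernoulli_real_eq_integral_map_inter_real`) and then specialised to `ι = Coin`.
No finiteness or measurability of `K` is needed.
-/

noncomputable section

namespace Summit.CriticalPhenomena.CardyFormulaZ2.Theorems.CardySelfRefinement.FarField

open scoped Topology ENNReal
open Filter Set MeasureTheory ProbabilityTheory
open Literature.Probability.LatticeModels Literature.Probability.Percolation
open Literature.Probability.Percolation.QuadCrossing
open Summit.CriticalPhenomena.CardyFormulaZ2.Theses.CardySelfRefinement

section Generic

variable {ι : Type*}

/-- `S ↦ S ∩ L` is measurable on `Set ι` (coordinatewise: `i ∈ S ∩ L ↔ i ∈ S ∧ i ∈ L`). -/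
theorem measurable_inter_right (L : Set ι) : Measurable fun S : Set ι => S ∩ L :=
  measurable_set_iff.2 fun i => (measurable_set_mem i).and measurable_const

/-- `S ↦ S \ L` is measurable on `Set ι` (coordinatewise: `i ∈ S \ L ↔ i ∈ S ∧ i ∉ L`). -/
theorem measurable_sdiff_right (L : Set ι) : Measurable fun S : Set ι => S \ L :=
  measurable_set_iff.2 fun i => (measurable_set_mem i).and measurable_const

/-- `(T, U) ↦ T ∪ U` is measurable on `Set ι × Set ι` (coordinatewise `or`). -/
theorem measurable_union_pair : Measurable fun q : Set ι × Set ι => q.1 ∪ q.2 :=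
  measurable_set_iff.2 fun i =>
    ((measurable_set_mem i).comp measurable_fst).or ((measurable_set_mem i).comp measurable_snd)

/-- `S ↦ S ∩ L` is measurable with respect to the σ-algebra generated by the coordinates
`ω ↦ (i ∈ ω)`, `i ∈ L` (a coordinate of `S ∩ L` is either a coordinate in `L` or the constant
`False`). -/
theorem measurable_inter_iSup_comap_mem (L : Set ι) :
    Measurable[⨆ i ∈ L, MeasurableSpace.comap (fun ω : Set ι => i ∈ ω) inferInstance]
      fun S : Set ι => S ∩ L := by
  refine @measurable_set_iff _ _
    (⨆ i ∈ L, MeasurableSpace.comap (fun ω : Set ι => i ∈ ω) inferInstance) _ |>.2 fun i => ?_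
  by_cases hi : i ∈ L
  · have h1 : Measurable[MeasurableSpace.comap (fun ω : Set ι => i ∈ ω) inferInstance]
        fun ω : Set ι => i ∈ ω :=
      Measurable.of_comap_le le_rfl
    have h2 : Measurable[⨆ i ∈ L, MeasurableSpace.comap (fun ω : Set ι => i ∈ ω) inferInstance]
        fun ω : Set ι => i ∈ ω :=
      h1.mono (le_iSup₂ (f := fun i (_ : i ∈ L) =>
        MeasurableSpace.comap (fun ω : Set ι => i ∈ ω) inferInstance) i hi) le_rfl
    simpa [hi] using h2
  · simp only [mem_inter_iff, hi, and_false]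
    exact measurable_const

/-- **The restriction to `K` and the far field off `K` are independent under `prodBernoulli p`**:
`IndepFun (· ∩ K) (· \ K)`.  The coordinates are mutually independent
(`prodBernoulli_iIndepFun_mem`), hence so are the σ-algebras generated by the coordinates in the
disjoint sets `K`, `Kᶜ` (`indep_iSup_of_disjoint`), which make `· ∩ K`, resp. `· \ K = · ∩ Kᶜ`,
measurable. -/
theorem prodBernoulli_indepFun_inter_sdiff (p : ι → unitInterval) (K : Set ι) :
    IndepFun (fun S : Set ι => S ∩ K) (fun S : Set ι => S \ K) (prodBernoulli p) := by
  have hind : iIndep (fun i => MeasurableSpace.comap (fun ω : Set ι => i ∈ ω) inferInstance)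
      (prodBernoulli p) :=
    (iIndepFun_iff_iIndep _ _ _).1 (prodBernoulli_iIndepFun_mem p)
  have hK := indep_iSup_of_disjoint (fun i => (measurable_set_mem i).comap_le) hind
    (disjoint_compl_right : Disjoint K Kᶜ)
  rw [IndepFun_iff_Indep]
  refine indep_of_indep_of_le_right
    (indep_of_indep_of_le_left hK (measurable_inter_iSup_comap_mem K).comap_le) ?_
  have h : (fun S : Set ι => S \ K) = fun S => S ∩ Kᶜ := funext fun S => Set.sdiff_eq S K
  rw [h]
  exact (measurable_inter_iSup_comap_mem Kᶜ).comap_le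

/-- **The law of the pair `(S ∩ K, S \ K)` under `prodBernoulli p` is the product of the law of
`S ∩ K` and the law of `S \ K`** (independence, `indepFun_iff_map_prod_eq_prod_map_map`). -/
theorem prodBernoulli_map_inter_sdiff_eq_prod (p : ι → unitInterval) (K : Set ι) :
    (prodBernoulli p).map (fun S : Set ι => (S ∩ K, S \ K)) =
      ((prodBernoulli p).map fun S : Set ι => S ∩ K).prod
        ((prodBernoulli p).map fun S : Set ι => S \ K) :=
  (indepFun_iff_map_prod_eq_prod_map_map (measurable_inter_right K).aemeasurable
    (measurable_sdiff_right K).aemeasurable).1 (prodBernoulli_indepFun_inter_sdiff p K)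

/-- For a measurable event `X` and `ν_K :=` the law of `S ∩ K` under `prodBernoulli p`, the
conditional probability `S ↦ ν_K {T | T ∪ (S \ K) ∈ X}` is measurable: it is the measure of the
section at `U = S \ K` of the measurable set `{(T, U) | T ∪ U ∈ X}`
(`measurable_measure_prodMk_right`). -/
theorem prodBernoulli_measurable_map_inter_real (p : ι → unitInterval) (K : Set ι)
    {X : Set (Set ι)} (hX : MeasurableSet X) :
    Measurable fun S : Set ι =>
      ((prodBernoulli p).map fun T : Set ι => T ∩ K).real {T | T ∪ (S \ K) ∈ X} := by
  have hE : MeasurableSet {q : Set ι × Set ι | q.1 ∪ q.2 ∈ X} := measurable_union_pair hX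
  exact ((measurable_measure_prodMk_right
    (μ := (prodBernoulli p).map fun T : Set ι => T ∩ K) hE).comp
      (measurable_sdiff_right K)).ennreal_toReal

/-- **Conditioning `prodBernoulli p` on the far field.**  For every measurable event `X` and every
set `K` of coordinates, `P(X) = ∫ ν_K {T | T ∪ (S \ K) ∈ X} dP(S)`, where `P = prodBernoulli p` and
`ν_K = P ∘ (· ∩ K)⁻¹` is the law of the configuration inside `K` (the rest absent): since
`S = (S ∩ K) ∪ (S \ K)`, `P(X)` is the mass of `{(T, U) | T ∪ U ∈ X}` under the law of the pair
`(S ∩ K, S \ K)`, which is the product `ν_K ⊗ law(S \ K)` (`prodBernoulli_map_inter_sdiff_eq_prod`);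
Fubini over the second factor (`Measure.prod_apply_symm`) and the change of variables `U = S \ K`
(`lintegral_map`) give the formula. -/
theorem prodBernoulli_real_eq_integral_map_inter_real (p : ι → unitInterval) (K : Set ι)
    {X : Set (Set ι)} (hX : MeasurableSet X) :
    (prodBernoulli p).real X =
      ∫ S, ((prodBernoulli p).map fun T : Set ι => T ∩ K).real {T | T ∪ (S \ K) ∈ X}
        ∂(prodBernoulli p) := by
  have hE : MeasurableSet {q : Set ι × Set ι | q.1 ∪ q.2 ∈ X} := measurable_union_pair hX
  have hg : Measurable fun U : Set ι => ((prodBernoulli p).map fun T : Set ι => T ∩ K)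
      ((fun T : Set ι => (T, U)) ⁻¹' {q : Set ι × Set ι | q.1 ∪ q.2 ∈ X}) :=
    measurable_measure_prodMk_right hE
  -- `X` is the preimage of `{(T, U) | T ∪ U ∈ X}` under `S ↦ (S ∩ K, S \ K)`
  have h1 : prodBernoulli p X =
      (prodBernoulli p).map (fun S : Set ι => (S ∩ K, S \ K)) {q | q.1 ∪ q.2 ∈ X} := by
    rw [Measure.map_apply ((measurable_inter_right K).prodMk (measurable_sdiff_right K)) hE]
    congr 1
    ext S
    simp
  rw [measureReal_def, h1, prodBernoulli_map_inter_sdiff_eq_prod, Measure.prod_apply_symm hE,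
    lintegral_map hg (measurable_sdiff_right K), ← integral_toReal]
  · rfl
  · exact (hg.comp (measurable_sdiff_right K)).aemeasurable
  · exact Eventually.of_forall fun S => measure_lt_top _ _

end Generic

/-- **Registered stub `prodBernoulli_real_eq_integral_cond`** (conditioning the coin product on the
far field): for every measurable event `X ⊆ Set Coin` and every set `K` of coins,
`P(X) = E[ν_K {T | T ∪ (S \ K) ∈ X}]` with `P = prodBernoulli p` and `ν_K` the law of `S ∩ K`
(the case `ι = Coin` of `prodBernoulli_real_eq_integral_map_inter_real`). -/
theorem prodBernoulli_real_eq_integral_cond (p : Coin → unitInterval) (K : Set Coin)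
    {X : Set (Set Coin)} (hX : MeasurableSet X) :
    (prodBernoulli p).real X =
      ∫ S, ((prodBernoulli p).map (fun T => T ∩ K)).real {T | T ∪ (S \ K) ∈ X}
        ∂(prodBernoulli p) :=
  prodBernoulli_real_eq_integral_map_inter_real p K hX

/-- **Registered stub `measurable_cond_real`**: the conditional probability
`S ↦ ν_K {T | T ∪ (S \ K) ∈ X}` of a measurable event `X ⊆ Set Coin` given the far field is
measurable (the case `ι = Coin` of `prodBernoulli_measurable_map_inter_real`). -/
theorem measurable_cond_real (p : Coin → unitInterval) (K : Set Coin) {X : Set (Set Coin)}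
    (hX : MeasurableSet X) :
    Measurable fun S : Set Coin =>
      ((prodBernoulli p).map (fun T => T ∩ K)).real {T | T ∪ (S \ K) ∈ X} :=
  prodBernoulli_measurable_map_inter_real p K hX

end Summit.CriticalPhenomena.CardyFormulaZ2.Theorems.CardySelfRefinement.FarField

end
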